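import Literature.Analysis.FluidPDE.PoincareHomotopyOperator
import Literature.Analysis.FluidPDE.LipschitzSqIntegrableDecay
import Literature.Analysis.FluidPDE.VectorCalculusProofs
import Literature.Analysis.FunctionSpaces.SmoothParametricIntegral
import Mathlib.Analysis.Distribution.AEEqOfIntegralContDiff
import Mathlib.Analysis.Calculus.BumpFunction.FiniteDimension
import HarnessLib

/-!
# Route `ExtremiserTransience`, support item `KStarAttained` (stmt-NavierStokesRegularity-24370):
# THE SMOOTH CONE POTENTIAL AND THE DIVERGENCE-FREE CUT-OFF OF AN ADMISSIBLE FIELD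

`--supports stmt-NavierStokesRegularity-24370`. Author: prover seat `ns-et-p1` (g3).

To test the Euler–Lagrange identity of an attainer `v` of `κ⋆` (`…KStarAttainedVariation`) against a
perturbation that EQUALS `v` near the contact set `{‖v‖ = M}` one needs a compactly supported, smooth,
divergence-free field agreeing with `v` on a large ball. The tree's Poincaré homotopy (cone) operator
`conePotential v x = ∫₀¹ t v(tx) × x dt` (`PoincareHomotopyOperator.lean`, Fonda 2018 Thm. 3.31, there proved
in the weak form `∫⟪conePotential v, curl Ψ⟫ = ∫⟪v, Ψ⟫`) supplies it:

* `KStar.contDiff_conePotential` — for `v ∈ C^∞` the cone potential is `C^∞` (differentiation under the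
  integral sign, `FunctionSpaces.contDiff_parametric_intervalIntegral`);
* `KStar.curl_conePotential` — **`curl (conePotential v) = v` pointwise** for smooth divergence-free `v`
  (weak form + integration by parts for the curl + `ae_eq_zero_of_integral_contDiff_smul_eq_zero` +
  continuity);
* `KStar.cutoff_field` — for a bump `χ` (`= 1` on `B̄(0, r_in)`), the field `curl (χ · conePotential v)` is
  `C^∞`, compactly supported, divergence free, and equals `v` on `B(0, r_in)`;
* `KStar.exists_radius_norm_lt` — an admissible field (`C^∞`, bounded gradient, `v ∈ L²`) is small outside a
  large ball (Lipschitz & square integrable ⇒ `v → 0` at infinity, `LipschitzSqIntegrableDecay`);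
* `KStar.exists_normBound_cutoff` — hence for `M > 0`, `‖v‖ ≤ M`: with `r_in` beyond the radius where
  `‖v‖ < M/2`, the perturbation `φ = curl (χ · conePotential v)` satisfies `‖v + εφ‖ ≤ (1 + ε)·M` everywhere
  for `|ε| < ε₀` (on the ball `v + εφ = (1+ε)v`; outside, `‖v‖ < M/2` absorbs `εφ`).

WHAT THIS IS NOT: nothing here concerns attainment of `κ⋆`, Navier–Stokes solutions or regularity; NS
regularity is NOT proved by anything here. [folklore]
-/

noncomputable section

open Set Filter Topology MeasureTheory Metric
open scoped InnerProductSpace RealInnerProductSpace ENNReal NNReal ContDiff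
open Literature.Analysis.FluidPDE

namespace Summit.NavierStokesRegularity.NavierStokesRegularity.Theorems

-- the problem directory repeats the summit name (`NavierStokesRegularity/NavierStokesRegularity`)
set_option linter.dupNamespace false

namespace DepletionLadder.KStar

variable {v : EuclideanSpace ℝ (Fin 3) → EuclideanSpace ℝ (Fin 3)}

/-! ## The cone potential of a smooth field is smooth, and its curl is the field -/

/-- **The cone potential of a `C^∞` field is `C^∞`** (the integrand `(t, x) ↦ t · v(tx) × x` is jointly
smooth; differentiation under the integral sign over `[0,1]`). [folklore] -/
theorem contDiff_conePotential (hv : ContDiff ℝ ∞ v) : ContDiff ℝ ∞ (conePotential v) := by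
  have h1 : ContDiff ℝ ∞ fun q : ℝ × EuclideanSpace ℝ (Fin 3) => v (q.1 • q.2) :=
    hv.comp (contDiff_fst.smul contDiff_snd)
  have hH : ContDiff ℝ ∞ fun q : ℝ × EuclideanSpace ℝ (Fin 3) => q.1 • crossCLM (v (q.1 • q.2)) q.2 :=
    contDiff_fst.smul ((crossCLM.contDiff.comp h1).clm_apply contDiff_snd)
  have h := Literature.Analysis.FunctionSpaces.contDiff_parametric_intervalIntegral hH 0 1
  have heq : conePotential v = fun p : EuclideanSpace ℝ (Fin 3) =>
      ∫ σ in (0 : ℝ)..1, σ • crossCLM (v (σ • p)) p := by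
    funext p
    rfl
  rw [heq]
  exact h

/-- **`curl (conePotential v) = v` pointwise** for a smooth divergence-free field (Fonda 2018, Thm. 3.31, in
strong form): the weak identity `∫⟪conePotential v, curl Ψ⟫ = ∫⟪v, Ψ⟫` of the tree and integration by parts
give `∫⟪curl (conePotential v) − v, Ψ⟫ = 0` for all `Ψ ∈ C^∞_c`, so the continuous field
`curl (conePotential v) − v` vanishes a.e., hence everywhere. [folklore] -/
theorem curl_conePotential (hv : ContDiff ℝ ∞ v) (hdiv : VectorCalculus.IsDivFree v)
    (x : EuclideanSpace ℝ (Fin 3)) : curl (conePotential v) x = v x := by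
  have hP : ContDiff ℝ ∞ (conePotential v) := contDiff_conePotential hv
  have hP1 : ContDiff ℝ 1 (conePotential v) := hP.of_le (by norm_cast)
  have hv1 : ContDiff ℝ 1 v := hv.of_le (by norm_cast)
  have hgc : Continuous fun y => curl (conePotential v) y - v y := (continuous_curl hP1).sub hv.continuous
  have hzero : ∀ θ : EuclideanSpace ℝ (Fin 3) → ℝ, ContDiff ℝ ∞ θ → HasCompactSupport θ →
      ∫ y, θ y • (curl (conePotential v) y - v y) = 0 := by
    intro θ hθ hθc
    have hint : Integrable (fun y => θ y • (curl (conePotential v) y - v y))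
        (volume : Measure (EuclideanSpace ℝ (Fin 3))) :=
      (hθ.continuous.smul hgc).integrable_of_hasCompactSupport hθc.smul_right
    refine ext_inner_left ℝ fun e => ?_
    rw [inner_zero_right, ← integral_inner hint e]
    have hΨ : ContDiff ℝ 1 fun y => θ y • e := (hθ.of_le (by norm_cast)).smul contDiff_const
    have hΨc : HasCompactSupport fun y => θ y • e := hθc.smul_right
    have hpt : ∀ y, ⟪e, θ y • (curl (conePotential v) y - v y)⟫ =
        ⟪curl (conePotential v) y, θ y • e⟫ - ⟪v y, θ y • e⟫ := fun y => by
      rw [inner_smul_right, inner_sub_right, inner_smul_right, inner_smul_right,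
        real_inner_comm (curl (conePotential v) y), real_inner_comm (v y)]
      ring
    rw [integral_congr_ae (Eventually.of_forall hpt), integral_sub, integral_inner_curl_eq_integral_inner_curl
      hP1 hΨ hΨc, integral_inner_conePotential_curl hv1 hdiv hΨ hΨc, sub_self]
    · exact integrable_inner_of_hasCompactSupport_right (continuous_curl hP1) hΨ.continuous hΨc
    · exact integrable_inner_of_hasCompactSupport_right hv.continuous hΨ.continuous hΨc
  have hae : ∀ᵐ y ∂(volume : Measure (EuclideanSpace ℝ (Fin 3))), curl (conePotential v) y - v y = 0 :=
    ae_eq_zero_of_integral_contDiff_smul_eq_zero hgc.locallyIntegrable hzero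
  have hg0 : (fun y => curl (conePotential v) y - v y) = fun _ => 0 :=
    Measure.eq_of_ae_eq hae hgc continuous_const
  exact sub_eq_zero.1 (congrFun hg0 x)

/-! ## The divergence-free cut-off `curl (χ · conePotential v)` -/

/-- Inside the plateau of a bump, its derivative vanishes. [folklore] -/
theorem fderiv_bump_eq_zero_of_mem_ball (χ : ContDiffBump (0 : EuclideanSpace ℝ (Fin 3)))
    {x : EuclideanSpace ℝ (Fin 3)} (hx : x ∈ ball (0 : EuclideanSpace ℝ (Fin 3)) χ.rIn) :
    fderiv ℝ χ x = 0 := by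
  have h : (χ : EuclideanSpace ℝ (Fin 3) → ℝ) =ᶠ[𝓝 x] fun _ => (1 : ℝ) := by
    filter_upwards [isOpen_ball.mem_nhds hx] with y hy
    exact χ.one_of_mem_closedBall (ball_subset_closedBall hy)
  rw [h.fderiv_eq, fderiv_const_apply]

/-- **The cut-off field.** For smooth divergence-free `v` and a bump `χ` centred at `0`, the field
`φ = curl (χ · conePotential v)` is `C^∞`, compactly supported, divergence free, and equals `v` on the ball
`B(0, χ.rIn)` (Leibniz rule for the curl: `curl (χ ψ) = χ curl ψ + ∇χ × ψ`, with `curl ψ = v`, `χ = 1`,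
`∇χ = 0` there). [folklore] -/
theorem cutoff_field (hv : ContDiff ℝ ∞ v) (hdiv : VectorCalculus.IsDivFree v)
    (χ : ContDiffBump (0 : EuclideanSpace ℝ (Fin 3))) :
    ContDiff ℝ ∞ (curl fun y => χ y • conePotential v y) ∧
      HasCompactSupport (curl fun y => χ y • conePotential v y) ∧
      VectorCalculus.IsDivFree (curl fun y => χ y • conePotential v y) ∧
      ∀ x ∈ ball (0 : EuclideanSpace ℝ (Fin 3)) χ.rIn, curl (fun y => χ y • conePotential v y) x = v x := by
  have hP : ContDiff ℝ ∞ (conePotential v) := contDiff_conePotential hv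
  have hη : ContDiff ℝ ∞ fun y => χ y • conePotential v y := χ.contDiff.smul hP
  have hcurl : ContDiff ℝ ∞ (curl fun y => χ y • conePotential v y) := by
    rw [curl_eq_curlCLM_comp]
    exact curlCLM.contDiff.comp (hη.fderiv_right (m := ∞) le_rfl)
  refine ⟨hcurl, hasCompactSupport_curl χ.hasCompactSupport.smul_right,
    fun x => divergence_curl_eq_zero_holds _ (hη.of_le (by norm_cast)) x, fun x hx => ?_⟩
  rw [curl_smul ((χ.contDiff (n := 1)).differentiable one_ne_zero x) (hP.differentiable (by simp) x),
    curl_conePotential hv hdiv, fderiv_bump_eq_zero_of_mem_ball χ hx,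
    χ.one_of_mem_closedBall (ball_subset_closedBall hx)]
  simp

/-! ## An admissible field is small at infinity -/

/-- **Decay radius.** A `C^∞` field with `‖Dv‖ ≤ B` and `v ∈ L²` (i.e. `∫⁻ ‖D⁰v‖ₑ² < ∞`) is uniformly small
off a large ball: for every `a > 0` there is `R ≥ 0` with `‖v x‖ < a` whenever `‖x‖ ≥ R` (Lipschitz and square
integrable ⇒ `v → 0` along the cocompact filter, `tendsto_cocompact_of_lipschitzWith_of_integrable_sq`). [folklore] -/
theorem exists_radius_norm_lt (hv : ContDiff ℝ ∞ v) {B : ℝ} (hB : ∀ x, ‖fderiv ℝ v x‖ ≤ B)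
    (h0 : ∫⁻ x, ‖iteratedFDeriv ℝ 0 v x‖ₑ ^ 2 < ⊤) {a : ℝ} (ha : 0 < a) :
    ∃ R : ℝ, 0 ≤ R ∧ ∀ x : EuclideanSpace ℝ (Fin 3), R ≤ ‖x‖ → ‖v x‖ < a := by
  have hB0 : 0 ≤ B := (norm_nonneg _).trans (hB 0)
  have hlip : LipschitzWith (Real.toNNReal B) v := by
    refine lipschitzWith_of_nnnorm_fderiv_le (hv.differentiable (by simp)) fun x => ?_
    rw [← NNReal.coe_le_coe, coe_nnnorm, Real.coe_toNNReal _ hB0]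
    exact hB x
  have h0' : ∫⁻ x, ‖v x‖ₑ ^ 2 < ⊤ := by
    refine lt_of_le_of_lt (le_of_eq (lintegral_congr fun x => ?_)) h0
    rw [← ofReal_norm, ← ofReal_norm, norm_iteratedFDeriv_zero]
  have hsq : Integrable (fun x => ‖v x‖ ^ 2) (volume : Measure (EuclideanSpace ℝ (Fin 3))) :=
    integrable_sq_norm_of_lintegral_lt_top hv.continuous h0'
  have ht : Tendsto v (cocompact (EuclideanSpace ℝ (Fin 3))) (𝓝 0) :=
    tendsto_cocompact_of_lipschitzWith_of_integrable_sq hlip hsq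
  have hev : ∀ᶠ x in cocompact (EuclideanSpace ℝ (Fin 3)), ‖v x‖ < a := by
    have := (Metric.tendsto_nhds.1 ht) a ha
    simpa [dist_zero_right] using this
  obtain ⟨K, hK, hKsub⟩ := mem_cocompact.1 hev
  obtain ⟨R, hR⟩ := hK.isBounded.subset_closedBall 0
  refine ⟨max R 0 + 1, by positivity, fun x hx => hKsub fun hxK => ?_⟩
  have := hR hxK
  rw [mem_closedBall, dist_zero_right] at this
  linarith [le_max_left R 0]

/-- **The norm bound for the cut-off perturbation.** Let `v` be smooth, divergence free, `‖v‖ ≤ M` with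
`M > 0`, and small (`‖v‖ < M/2`) outside the ball `B̄(0, R)`; let `χ` be a bump with plateau radius
`χ.rIn > R` and `φ = curl (χ · conePotential v)`. Then for some `ε₀ > 0` and all `|ε| < ε₀`:
`‖v + εφ‖ ≤ (1 + ε)·M` everywhere (`= (1+ε)‖v‖` on the plateau, `≤ M/2 + |ε|·sup‖φ‖` outside). [folklore] -/
theorem exists_normBound_cutoff (hv : ContDiff ℝ ∞ v) (hdiv : VectorCalculus.IsDivFree v) {M R : ℝ}
    (hM : ∀ x, ‖v x‖ ≤ M) (hMpos : 0 < M) (hR : ∀ x : EuclideanSpace ℝ (Fin 3), R ≤ ‖x‖ → ‖v x‖ < M / 2)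
    (χ : ContDiffBump (0 : EuclideanSpace ℝ (Fin 3))) (hχ : R < χ.rIn) :
    ∃ ε₀ : ℝ, 0 < ε₀ ∧ ∀ ε : ℝ, |ε| < ε₀ → ∀ x,
      ‖v x + ε • curl (fun y => χ y • conePotential v y) x‖ ≤ (1 + (1 : ℝ) * ε) * M := by
  obtain ⟨hφ, hφc, -, hball⟩ := cutoff_field hv hdiv χ
  obtain ⟨C, hC⟩ := hφ.continuous.bounded_above_of_compact_support hφc
  have hC0 : 0 ≤ C := (norm_nonneg _).trans (hC 0)
  refine ⟨M / (2 * (C + M + 1)), by positivity, fun ε hε x => ?_⟩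
  have hε1 : |ε| < 1 / 2 := by
    refine lt_of_lt_of_le hε ?_
    rw [div_le_div_iff₀ (by positivity) (by norm_num)]
    nlinarith
  have hεle : -(1 / 2 : ℝ) < ε := by linarith [neg_abs_le ε]
  rw [one_mul]
  by_cases hx : x ∈ ball (0 : EuclideanSpace ℝ (Fin 3)) χ.rIn
  · rw [hball x hx, show v x + ε • v x = (1 + ε) • v x by rw [add_smul, one_smul], norm_smul]
    calc ‖(1 : ℝ) + ε‖ * ‖v x‖ = (1 + ε) * ‖v x‖ := by
          rw [Real.norm_eq_abs, abs_of_pos (by linarith)]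
      _ ≤ (1 + ε) * M := mul_le_mul_of_nonneg_left (hM x) (by linarith)
  · have hxR : R ≤ ‖x‖ := by
      rw [mem_ball, dist_zero_right, not_lt] at hx
      exact hχ.le.trans hx
    have hvx := hR x hxR
    have hεC : |ε| * ‖curl (fun y => χ y • conePotential v y) x‖ ≤ M / (2 * (C + M + 1)) * C :=
      mul_le_mul hε.le (hC x) (norm_nonneg _) (by positivity)
    have hkey : M / 2 + M / (2 * (C + M + 1)) * C ≤ (1 - M / (2 * (C + M + 1))) * M := by
      rw [div_mul_eq_mul_div, sub_mul, div_mul_eq_mul_div]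
      rw [div_add_div _ _ (by norm_num : (2:ℝ) ≠ 0) (by positivity), le_sub_iff_add_le,
        div_add_div _ _ (by positivity) (by positivity), div_le_iff₀ (by positivity)]
      nlinarith [mul_pos hMpos hMpos, mul_nonneg hC0 hMpos.le]
    calc ‖v x + ε • curl (fun y => χ y • conePotential v y) x‖
        ≤ ‖v x‖ + ‖ε • curl (fun y => χ y • conePotential v y) x‖ := norm_add_le _ _
      _ = ‖v x‖ + |ε| * ‖curl (fun y => χ y • conePotential v y) x‖ := by
          rw [norm_smul, Real.norm_eq_abs]
      _ ≤ M / 2 + M / (2 * (C + M + 1)) * C := add_le_add hvx.le hεC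
      _ ≤ (1 - M / (2 * (C + M + 1))) * M := hkey
      _ ≤ (1 + ε) * M := by
          refine mul_le_mul_of_nonneg_right ?_ hMpos.le
          linarith [neg_abs_le ε]

end DepletionLadder.KStar

end Summit.NavierStokesRegularity.NavierStokesRegularity.Theorems

end
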